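import Summits.ResolutionOfSingularities.ResolutionOfSingularities.Theorems.PurelyInseparableDim4StepKitState
import HarnessLib

/-!
# Zoo certificates ‖ K — row J-005 «C0-T (+3)»: a MODE-1h edge on which the shade rises by THREE

[OURS · census certificate · counted 0.]  Census cell «res-dim4-pi» (D-0157 DOOR 2), third file of
the TY-4 series (`…ZooCert` J-003, `…ZooCertJ001` J-001), first consumer of res-dim4-p-13's
`StepKit` (`step1h_of … (by decide) …`): `boards/JUMPS.md` row **J-005** (crit-3 BANK-A3-01; K three
ways: hand ∧ a3 script ∧ eng-B replay) — class (4,1), `p = q = 2`, variables `(x₁,x₂,x₃,x₄) = Fin 4`: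

`a = (F = x₂x₄³ + x₂³x₄ + x₁²x₂x₃²x₄ = x₂x₄(x₂ + x₄ + x₁x₃)², r = (x₂ ↦ 1, x₄ ↦ 1), exc = {x₂,x₄})`,
`ord₀ F = 4`, shade `d = 2`, `g = 0`.  The MODE-1h centre is the plane `V(z, x₂, x₄)` (`ord_S F = 2`;
no coordinate hyperplane is `2`-fold), `perm2 = 0` (eclass C0: `Σ_S r + d = 4 > 2`).  At the point
`x₄ = 1` of the `x₂`-chart: chart transform `x₄(x₂x₄ + x₂ + x₁x₃)²`, translation
`(x₄+1)(x₂x₄ + x₁x₃)²`, cleaning deletes the square `(x₂x₄ + x₁x₃)²`, the component `x₄` is lost and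
`x₂` gets multiplicity `2 − 2 = 0`:  `k = (x₄(x₂x₄ + x₁x₃)² = x₂²x₄³ + x₁²x₃²x₄, r = 0, exc = {x₂})`,
`ord₀ = 5`, shade `5`: **RISE:d 2 → 5 (+3)** — a NEW SPECIMEN of the KNOWN perm2 = 0 translated
class (PERM2-0-T): outside condition (2) Moh's `+p^{e−1} = +1` bound is not available and is
exceeded.  Nothing here proves or disproves resolution of singularities in dim ≥ 4 / char p.
-/

-- house layout `Summits/<Summit>/<Problem>` doubles the namespace component (as in the Target file)
set_option linter.dupNamespace false

noncomputable section

namespace Summit.ResolutionOfSingularities.ResolutionOfSingularities.Theorems.PIDim4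

namespace ZooCert.J005

open StepKit

/-- the parent `a = (x₂x₄³ + x₂³x₄ + x₁²x₂x₃²x₄, (x₂ ↦ 1, x₄ ↦ 1), {x₂, x₄})`, presented. [folklore] -/
def a : SData 4 (ZMod 2) := ⟨[(![0, 1, 0, 3], 1), (![0, 3, 0, 1], 1), (![2, 1, 2, 1], 1)], ![0, 1, 0, 1], {1, 3}⟩

/-- the child `k = (x₂²x₄³ + x₁²x₃²x₄, 0, {x₂})`, presented. [folklore] -/
def k : SData 4 (ZMod 2) := ⟨[(![0, 2, 0, 3], 1), (![2, 0, 2, 1], 1)], ![0, 0, 0, 0], {1}⟩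

/-- the point `x₄ = 1` of the `x₂`-chart. [folklore] -/
def b : Fin 4 → ZMod 2 := ![0, 0, 0, 1]

/-- **J-005 is a MODE-1h step** `a ⟶ k` (plane centre `V(z,x₂,x₄)`, `x₂`-chart, `x₄ = 1`). [folklore] -/
theorem step1h_a_k : Step1h 2 a.toState k.toState :=
  step1h_of {1, 3} 1 b (by decide) (by decide) (by decide) (by decide) (by decide) (by decide)

/-- the centre violates Hauser–Perlega's condition (2) (`perm2 = 0`, eclass C0). [folklore] -/
theorem not_perm2_a : ¬ Perm2 {1, 3} a.toState := by
  rw [perm2_iff]; decide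

/-- shade `2` before, `5` after. [folklore] -/
theorem shade_a : a.toState.shade = 2 := by rw [shade_toState]; decide
/-- see `shade_a`. [folklore] -/
theorem shade_k : k.toState.shade = 5 := by rw [shade_toState]; decide

/-- **RISE:d by `+3`.** [folklore] -/
theorem riseD_a_k : RiseD a.toState k.toState := (riseD_iff a k).mpr (by decide)

end ZooCert.J005

open ZooCert.J005 in
/-- **J-005 ‖ K.**  In class (4,1) at `p = 2` there is a MODE-1h edge (perm2 = 0, translated point)
on which the shade rises from `2` to `5`: three times Moh's `+1`.  Census value (KNOWN mechanism
class PERM2-0-T, new specimen); nothing about resolution of singularities. [folklore] -/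
theorem exists_step1h_shade_add_three :
    ∃ s s' : State (ZMod 2), Step1h 2 s s' ∧ s.shade = 2 ∧ s'.shade = 5 :=
  ⟨a.toState, k.toState, step1h_a_k, shade_a, shade_k⟩

end Summit.ResolutionOfSingularities.ResolutionOfSingularities.Theorems.PIDim4

end
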